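import Summits.BirchSwinnertonDyer.Rank1Residual.Additive.QuadraticBranchMazurTateLimit
import Summits.BirchSwinnertonDyer.Rank1Residual.Additive.QuadraticBranchCharacterEvaluation
import Summits.BirchSwinnertonDyer.Rank1Residual.Additive.QuadraticBranchOddStrictSelmer
import HarnessLib

/-!
# EXISTENCE of Kobayashi's minus `p`-adic `L`-function `L_p⁻(V, η, X)` on the quadratic branch
# `η = ω^{(p−1)/2}` (Kobayashi 2003, Thm. 3.2 with (3.5), (3.7)): `∃ L, IsQuadraticBranchMinusLFunction f p ϖ L`
# — the analytic half of the O10 class node's binder `hdata` — file 5 of 5 (proofs only)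

HONEST FRAMING (cell `bsd-potss`, run/shared/lean/pub/bsd-potss/, FULL-BSD rank ≤ 1 programme
tranche 1b, human ruling D-0036; seat `bsd-potss-ctrl` = "signed control along the quadratic branch"):
the programme's target of record is FULL BSD for every analytic-rank ≤ 1 curve over `ℚ`; this seat's
object is the quadratic (`η = ω^{(p−1)/2}`) branch of Kobayashi's signed theory for the good
`a_p = 0` twin `V` of an additive potentially supersingular curve `W = V ⊗ η` (classes Gss2 / O5 `e = 2`,
O10-PS). THIS FILE: THEOREMS ONLY (no definition, no `sorry`); NOTHING about `BSD(W, p)`, (C1_η), (C2_η-GZ) or (C3_η) of any pair is claimed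
or moved; no named Literature fact is introduced; axioms standard.

## What

`IsQuadraticBranchMinusLFunction f p ϖ L` (cc-typer-6, `QuadraticBranchOddStrictSelmer.lean`):
`L(0) = 0` and, for a unit `u ∈ ℤ_p^×`, for every ODD `n` and every `ψ` mod `p^{n+1}` of order `2pⁿ`,
`L(ζ − 1) · ω⁺_n(ζ − 1) = (−1)^{(n+1)/2} u ϖ ∑_a ψ(a)[a/p^{n+1}]^δ_f` (`ζ = ψ(1+p)`). It is quantified
over by (C1_η)'s odd companion, (C3_η) `QuadraticBranchOddStrictExactControlOfPlusMCAt`, C-cc-1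
`QuadraticBranchPAdicGrossZagierValuationAt`, and bound as DATA `hL` by every pair/class consumer
(`bsdp_of_quadraticBranchPAdicGrossZagierValuation_of_exactControl[_model]`,
`X12.O10.lowerHalfOnType_IstarZero_of_valuation_of_exactControl` — binder `hdata`). Uniqueness up to
`ℤ_p^×` is x1b's `IsQuadraticBranchMinusLFunction.exists_units_smul_eq`; EXISTENCE was open in the tree.

## Theorems

* `exists_quadraticBranchMinus_mazurTate` — the Mazur–Tate form: `M ∈ Λ`, `M(0) = 0`, and at every
  `ψ` of order `2pⁿ` (`n` odd) `ω⁺_n(ζ − 1) ≠ 0` and `M(ζ − 1) ω⁺_n(ζ − 1) = (−1)^{(n+1)/2} ∑ ψ(a)[a/p^{n+1}]^δ`.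
* `exists_isQuadraticBranchMinusLFunction` — for `p` odd, `f` a rational newform of level prime to
  `p` with `a_p(f) = 0` and ANY `p`-integral `ϖ ∈ ℚ`: `∃ L, IsQuadraticBranchMinusLFunction f p ϖ L`
  (`L = ϖ·M`, `u = 1`).
* `exists_isQuadraticBranchMinusLFunction_of_isNewformOf` — the same for the newform of a curve `V`
  with good reduction at `p` and `a_p(V) = 0`.
* `quadraticBranch_hdata_of_periodRatio` — the O10 binder `hdata` FOLLOWS from the `p`-integral period
  ratio alone (what remains displayed is the period input, not Kobayashi's Thm. 3.2).

WHAT THIS IS NOT: not a statement about `L ≠ 0` (Rohrlich; the rank-one chain takes `coeff₁ L ≠ 0`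
from (C2_η-GZ)); not the PLUS function `L_p⁺(V, η, X)` of (C1_η) (the even levels; same method, not
needed by the consumers, left TODO); not integrality of `ϖ` (displayed: `‖ϖ‖_p ≤ 1`); nothing about
the main conjecture or about BSD of any curve.

References: [Kobayashi2003] Thm. 3.2, (3.4)–(3.7) (p. 7); [Pollack2003] Thm. 5.6, Lemma 4.7, Prop. 6.18;
[MazurTateTeitelbaum1986Invent] §I.10 (10.2), §I.13.
-/

noncomputable section

open scoped Classical MatrixGroups ModularForm

open CongruenceSubgroup Polynomial Literature.NumberTheory.EllipticCurves
  Literature.NumberTheory.EllipticCurves.ModularForms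

namespace Summit.BirchSwinnertonDyer.Rank1Residual.Additive

/-! ## §8 Assembly: Kobayashi's `L_p⁻(V, η, X)` exists on the quadratic branch -/

section Assembly

variable {N : ℕ} [NeZero N] {f : CuspForm (Gamma0 N) 2} {p : ℕ} [hp : Fact p.Prime]

/-- The series `∑ ι(l_k) 0^k` sums to `ι(l_0)`. [folklore] -/
private theorem tsum_coeff_mul_zero_pow (L : IwasawaAlgebra p) :
    ∑' k, ((algebraMap ℚ_[p] ℂ_[p]).comp (algebraMap ℤ_[p] ℚ_[p])) (PowerSeries.coeff k L) *
      (0 : ℂ_[p]) ^ k =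
      ((algebraMap ℚ_[p] ℂ_[p]).comp (algebraMap ℤ_[p] ℚ_[p])) (PowerSeries.constantCoeff L) := by
  rw [tsum_eq_single 0]
  · simp
  · intro k hk
    simp [zero_pow hk]

/-- **EXISTENCE on the quadratic branch, Mazur–Tate form.** For `p` odd, `f` a rational newform of
level `N` prime to `p` with `a_p(f) = 0`, there is `M ∈ Λ = ℤ_p⟦T⟧` with `M(0) = 0` and, for every
ODD `n` and every Dirichlet character `ψ` modulo `p^{n+e₀}` of order `2pⁿ`, with `ζ = ψ(γ)`:
`ω⁺_n(ζ − 1) ≠ 0` and `M(ζ − 1) · ω⁺_n(ζ − 1) = (−1)^{(n+1)/2} ∑_a ψ(a)[a/p^{n+1}]^δ_f` in `ℂ_p`.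
[cite: Kobayashi2003, Thm. 3.2, (3.5) and (3.7) (p. 7)] [cite: Pollack2003, Prop. 6.18] -/
theorem exists_quadraticBranchMinus_mazurTate (hp2 : p ≠ 2) (hf0 : IsNewform0 f)
    (hQ : coeffField f = ⊥) (hpN : ¬ p ∣ N) (hap : cuspCoeff f p = ((0 : ℤ) : ℂ)) :
    ∃ M : IwasawaAlgebra p, PowerSeries.constantCoeff M = 0 ∧
      ∀ n : ℕ, Odd n → ∀ ψ : DirichletCharacter ℂ_[p] (p ^ (n + cyclotomicExponent p)),
        orderOf ψ = 2 * p ^ n →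
          (cyclotomicOmegaPlus p n).eval₂ (algebraMap ℤ ℂ_[p])
              (ψ (cyclotomicGenerator p : ZMod (p ^ (n + cyclotomicExponent p))) - 1) ≠ 0 ∧
          HasSum (fun k : ℕ ↦ ((algebraMap ℚ_[p] ℂ_[p]).comp (algebraMap ℤ_[p] ℚ_[p]))
              (PowerSeries.coeff k M) *
            (ψ (cyclotomicGenerator p : ZMod (p ^ (n + cyclotomicExponent p))) - 1) ^ k)
            ((-1 : ℂ_[p]) ^ ((n + 1) / 2) *
              (if Even (p / 2) then ratTwistedSymbolSum f ψ else ratMinusTwistedSymbolSum f ψ) /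
              (cyclotomicOmegaPlus p n).eval₂ (algebraMap ℤ ℂ_[p])
                (ψ (cyclotomicGenerator p : ZMod (p ^ (n + cyclotomicExponent p))) - 1)) := by
  obtain ⟨M, hM⟩ := exists_isCongrModOmega_quadraticBranch_odd hp2 hf0 hQ hpN hap
  set ι : ℤ_[p] →+* ℂ_[p] := (algebraMap ℚ_[p] ℂ_[p]).comp (algebraMap ℤ_[p] ℚ_[p]) with hι
  refine ⟨M, ?_, fun n hn ψ hψ ↦ ?_⟩
  · -- `M(0) = 0` from the congruence at level `1` evaluated at `T = 0` and `θ_1(η)(0) = 0`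
    have hω1 : cyclotomicOmegaPlus p (2 * 0 + 1) = 1 := by
      rw [cyclotomicOmegaPlus_two_mul_add_one, mul_zero, cyclotomicOmegaPlus_zero]
    have h0 := (hM 0).eval₂_eq (z := 0) (by simp) (by simp)
    rw [eval₂_at_zero, coeff_zero_eq_eval_zero, eval₂_mul, eval₂_pow, eval₂_neg, eval₂_one, hω1,
      eval₂_one, tsum_coeff_mul_zero_pow, mul_zero, zero_add,
      eval_zero_quadraticBranchMazurTateElement_one f hp2 hf0 hQ hpN hap, map_zero] at h0
    have h1 : ι (PowerSeries.constantCoeff M) = 0 := by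
      have : (-1 : ℂ_[p]) ^ 1 * 1 ≠ 0 := by norm_num
      rw [hι]
      exact (mul_eq_zero.mp h0.symm).resolve_left this
    exact (map_eq_zero_iff ι ((algebraMap ℚ_[p] ℂ_[p]).injective.comp
      (IsFractionRing.injective ℤ_[p] ℚ_[p]))).mp h1
  · obtain ⟨m, rfl⟩ := hn
    set ζ : ℂ_[p] := ψ (cyclotomicGenerator p : ZMod (p ^ (2 * m + 1 + cyclotomicExponent p)))
      with hζ
    have hordζ := orderOf_apply_cyclotomicGenerator_of_orderOf_eq hp2 ψ hψ
    have hprim : IsPrimitiveRoot ζ (p ^ (2 * m + 1)) := hordζ ▸ IsPrimitiveRoot.orderOf ζ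
    have hpow : ζ ^ p ^ (2 * m + 1) = 1 := hordζ ▸ pow_orderOf_eq_one ζ
    have hz : ‖ζ - 1‖ < 1 := norm_sub_one_lt_one_of_pow_prime_pow_eq_one hpow
    have hzn : (1 + (ζ - 1)) ^ p ^ (2 * m + 1) = 1 := by rwa [add_sub_cancel]
    have hω : (cyclotomicOmegaPlus p (2 * m + 1)).eval₂ (algebraMap ℤ ℂ_[p]) (ζ - 1) ≠ 0 :=
      eval₂_cyclotomicOmegaPlus_ne_zero ⟨m, rfl⟩ hprim
    refine ⟨hω, ?_⟩
    have h1 := (hM m).eval₂_eq hz hzn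
    rw [eval₂_quadraticBranchMazurTateElement_eq f hp2 ψ hψ, eval₂_mul, eval₂_pow, eval₂_neg,
      eval₂_one] at h1
    have hsum : HasSum (fun k ↦ ι (PowerSeries.coeff k M) * (ζ - 1) ^ k)
        (∑' k, ι (PowerSeries.coeff k M) * (ζ - 1) ^ k) :=
      (summable_map_coeff_mul_pow _ (norm_algebraMap_coeff_le_one M) hz).hasSum
    have hval : ∑' k, ι (PowerSeries.coeff k M) * (ζ - 1) ^ k =
        (-1 : ℂ_[p]) ^ ((2 * m + 1 + 1) / 2) *
          (if Even (p / 2) then ratTwistedSymbolSum f ψ else ratMinusTwistedSymbolSum f ψ) /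
          (cyclotomicOmegaPlus p (2 * m + 1)).eval₂ (algebraMap ℤ ℂ_[p]) (ζ - 1) := by
      rw [show (2 * m + 1 + 1) / 2 = m + 1 by omega, eq_div_iff hω, h1, hι]
      have hs : ((-1 : ℂ_[p]) ^ (m + 1)) * (-1) ^ (m + 1) = 1 := by
        rw [← mul_pow, neg_one_mul, neg_neg, one_pow]
      linear_combination (-((cyclotomicOmegaPlus p (2 * m + 1)).eval₂ (algebraMap ℤ ℂ_[p]) (ζ - 1) *
        ∑' k, ι (PowerSeries.coeff k M) * (ζ - 1) ^ k)) * hs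
    rwa [hval] at hsum

/-- **EXISTENCE of Kobayashi's `L_p⁻(V, η, X)` on the quadratic branch** (Kobayashi 2003 Thm. 3.2 with
(3.5) and (3.7), `η = ω^{(p−1)/2}`; the input `hdata` (ii) of the O10 class node
`X12.ClassClosureO10Refined`): for `p` odd, `f` a rational newform of level prime to `p` with
`a_p(f) = 0`, and ANY `p`-integral period ratio `ϖ ∈ ℚ` (`‖ϖ‖_p ≤ 1`), there is `L ∈ Λ = ℤ_p⟦X⟧` with
`IsQuadraticBranchMinusLFunction f p ϖ L` — namely `L = ϖ · M` with `M` the Mazur–Tate limit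
`lim_m (−1)^{m+1} θ_{2m+1}(f, η)/ω⁺_{2m+1}` (unit `u = 1`). Algebraic reconstruction from the
`η`-twisted modular elements (three-term relation at `a_p = 0`, trivial zeros at the even-order roots
of unity, completeness of `Λ` along `T ω⁻_{2m+1}`), exactly as the tree's trivial-branch
`pollack_exists_plusMinusPAdicLFunction_holds`; no analytic `L_p(E, α, η, X)` and no `log^±` needed.
[cite: Kobayashi2003, Thm. 3.2, (3.5) and (3.7) (p. 7)] [cite: Pollack2003, Thm. 5.6 and Prop. 6.18]
[cite: MazurTateTeitelbaum1986Invent, §I.10 Prop. (10.2) and §I.13] -/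
theorem exists_isQuadraticBranchMinusLFunction (hp2 : p ≠ 2) (hf0 : IsNewform0 f)
    (hQ : coeffField f = ⊥) (hpN : ¬ p ∣ N) (hap : cuspCoeff f p = ((0 : ℤ) : ℂ)) (ϖ : ℚ)
    (hϖ : ‖(ϖ : ℚ_[p])‖ ≤ 1) :
    ∃ L : IwasawaAlgebra p, IsQuadraticBranchMinusLFunction f p ϖ L := by
  have he : cyclotomicExponent p = 1 := if_neg hp2
  obtain ⟨M, hM0, hM⟩ := exists_quadraticBranchMinus_mazurTate hp2 hf0 hQ hpN hap
  set c : ℤ_[p] := ⟨(ϖ : ℚ_[p]), hϖ⟩ with hc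
  refine ⟨PowerSeries.C c * M, ?_, 1, fun n hn ψ hψ ↦ ?_⟩
  · rw [map_mul, hM0, mul_zero]
  · -- move `ψ` to the tree's level `n + e₀ = n + 1`
    have key : ∀ (K : ℕ) (hK : K = n + cyclotomicExponent p)
        (ψ : DirichletCharacter ℂ_[p] (p ^ K)), orderOf ψ = 2 * p ^ n →
        HasSum (fun k : ℕ ↦ ((algebraMap ℚ_[p] ℂ_[p]).comp (algebraMap ℤ_[p] ℚ_[p]))
            (PowerSeries.coeff k (PowerSeries.C c * M)) *
          (ψ (cyclotomicGenerator p : ZMod (p ^ K)) - 1) ^ k)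
          ((-1 : ℂ_[p]) ^ ((n + 1) / 2) *
            algebraMap ℚ_[p] ℂ_[p] ((((1 : ℤ_[p]ˣ) : ℤ_[p]) : ℚ_[p]) * (ϖ : ℚ_[p])) *
            (if Even (p / 2) then ratTwistedSymbolSum f ψ else ratMinusTwistedSymbolSum f ψ) /
            (cyclotomicOmegaPlus p n).eval₂ (algebraMap ℤ ℂ_[p])
              (ψ (cyclotomicGenerator p : ZMod (p ^ K)) - 1)) := by
      intro K hK ψ hψ
      subst hK
      obtain ⟨-, h⟩ := hM n hn ψ hψ
      have hιc : ((algebraMap ℚ_[p] ℂ_[p]).comp (algebraMap ℤ_[p] ℚ_[p])) c =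
          algebraMap ℚ_[p] ℂ_[p] (ϖ : ℚ_[p]) := by
        rw [RingHom.comp_apply]
        rfl
      have h2 := h.mul_left (algebraMap ℚ_[p] ℂ_[p] (ϖ : ℚ_[p]))
      have hfun : (fun k : ℕ ↦ ((algebraMap ℚ_[p] ℂ_[p]).comp (algebraMap ℤ_[p] ℚ_[p]))
            (PowerSeries.coeff k (PowerSeries.C c * M)) *
          (ψ (cyclotomicGenerator p : ZMod (p ^ (n + cyclotomicExponent p))) - 1) ^ k) =
          fun k ↦ algebraMap ℚ_[p] ℂ_[p] (ϖ : ℚ_[p]) *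
            (((algebraMap ℚ_[p] ℂ_[p]).comp (algebraMap ℤ_[p] ℚ_[p])) (PowerSeries.coeff k M) *
              (ψ (cyclotomicGenerator p : ZMod (p ^ (n + cyclotomicExponent p))) - 1) ^ k) := by
        funext k
        rw [PowerSeries.coeff_C_mul, map_mul, hιc, mul_assoc]
      have hvalue : (-1 : ℂ_[p]) ^ ((n + 1) / 2) *
            algebraMap ℚ_[p] ℂ_[p] ((((1 : ℤ_[p]ˣ) : ℤ_[p]) : ℚ_[p]) * (ϖ : ℚ_[p])) *
            (if Even (p / 2) then ratTwistedSymbolSum f ψ else ratMinusTwistedSymbolSum f ψ) /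
            (cyclotomicOmegaPlus p n).eval₂ (algebraMap ℤ ℂ_[p])
              (ψ (cyclotomicGenerator p : ZMod (p ^ (n + cyclotomicExponent p))) - 1) =
          algebraMap ℚ_[p] ℂ_[p] (ϖ : ℚ_[p]) * ((-1 : ℂ_[p]) ^ ((n + 1) / 2) *
            (if Even (p / 2) then ratTwistedSymbolSum f ψ else ratMinusTwistedSymbolSum f ψ) /
            (cyclotomicOmegaPlus p n).eval₂ (algebraMap ℤ ℂ_[p])
              (ψ (cyclotomicGenerator p : ZMod (p ^ (n + cyclotomicExponent p))) - 1)) := by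
        rw [Units.val_one, PadicInt.coe_one, one_mul]
        ring
      rw [hfun, hvalue]
      exact h2
    exact key (n + 1) (by rw [he]) ψ hψ

end Assembly

/-! ## §9 Corollaries: the newform of a good `a_p = 0` curve; the O10 binder `hdata` reduced to the
`p`-integrality of the period ratio -/

section Curve

variable {V : WeierstrassCurve ℚ} [V.IsElliptic] [V.IsGloballyMinimal] {N : ℕ} [NeZero N]
  {f : CuspForm (Gamma0 N) 2} {p : ℕ} [hp : Fact p.Prime]

/-- **Kobayashi's `L_p⁻(V, η, X)` EXISTS for the good `a_p = 0` curve `V`** (Kobayashi 2003 Thm. 3.2,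
branch `η = ω^{(p−1)/2}`): for `p` odd, `f` the newform of `V`, `V` with good reduction at `p` and
`a_p(V) = 0`, and any `p`-integral `ϖ ∈ ℚ`, some `L ∈ Λ` satisfies `IsQuadraticBranchMinusLFunction f p ϖ L`
(`p ∤ N` by `not_dvd_level_of_isNewformOf`, `a_p(f) = a_p(V) = 0` by
`cuspCoeff_eq_frobeniusTrace_of_isNewformOf_holds`). With x1b's uniqueness
(`IsQuadraticBranchMinusLFunction.exists_units_smul_eq`) the branch function is now an OBJECT of the
tree: it exists and is unique up to `ℤ_p^×`. [cite: Kobayashi2003, Thm. 3.2, (3.5) and (3.7) (p. 7)]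
[cite: Pollack2003, Thm. 5.6 and Prop. 6.18] -/
theorem exists_isQuadraticBranchMinusLFunction_of_isNewformOf (hp2 : p ≠ 2) (hf : IsNewformOf V f)
    (hgood : V.HasGoodReductionAtPrime p) (hap : V.frobeniusTrace p = 0) (ϖ : ℚ)
    (hϖ : ‖(ϖ : ℚ_[p])‖ ≤ 1) :
    ∃ L : IwasawaAlgebra p, IsQuadraticBranchMinusLFunction f p ϖ L := by
  have hap' : cuspCoeff f p = ((0 : ℤ) : ℂ) := by
    rw [cuspCoeff_eq_frobeniusTrace_of_isNewformOf_holds hf hgood, hap]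
  exact exists_isQuadraticBranchMinusLFunction hp2 hf.1 hf.coeffField_eq_bot
    (not_dvd_level_of_isNewformOf hf hgood) hap' ϖ hϖ

omit [V.IsElliptic] [V.IsGloballyMinimal] [NeZero N] in
/-- **The O10 class node's analytic binder `hdata` REDUCED to the period ratio** (bsd-cm-inert,
`X12/ClassClosureO10Refined.lean`: "`∃ ϖ` period ratio ∧ `∃ L, IsQuadraticBranchMinusLFunction f p ϖ L`",
displayed there as two unproved existence statements): given, for every good `a_p = 0` curve `V` at
the odd prime `p`, a `p`-INTEGRAL rational period ratio `ϖ` of the parity of `η` (`ϖ·Ω_V = Ω⁺_f`,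
resp. `ϖ·|Ω⁻(V)| = Ω⁻_f`; `‖ϖ‖_p ≤ 1` — e.g. a `p`-adic unit, as for `p ∤ N_V`, `p` odd), the binder
holds: the Kobayashi-Thm-3.2 half is `exists_isQuadraticBranchMinusLFunction_of_isNewformOf`. What
remains displayed is ONLY the period-ratio input. [cite: Kobayashi2003, Thm. 3.2 (p. 7)] -/
theorem quadraticBranch_hdata_of_periodRatio (hp2 : p ≠ 2)
    (hper : ∀ (V : WeierstrassCurve ℚ) [V.IsElliptic] [V.IsGloballyMinimal]
      {N : ℕ} [NeZero N] (f : CuspForm (Gamma0 N) 2), IsNewformOf V f →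
      V.HasGoodReductionAtPrime p → V.frobeniusTrace p = 0 →
      ∃ ϖ : ℚ, ‖(ϖ : ℚ_[p])‖ ≤ 1 ∧
        (if Even (p / 2) then (ϖ : ℝ) * V.realPeriodRat = plusPeriod f
          else (ϖ : ℝ) * V.imaginaryPeriodRat = minusPeriod f)) :
    ∀ (V : WeierstrassCurve ℚ) [V.IsElliptic] [V.IsGloballyMinimal]
      {N : ℕ} [NeZero N] (f : CuspForm (Gamma0 N) 2), IsNewformOf V f →
      V.HasGoodReductionAtPrime p → V.frobeniusTrace p = 0 →
      ∃ ϖ : ℚ, (if Even (p / 2) then (ϖ : ℝ) * V.realPeriodRat = plusPeriod f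
          else (ϖ : ℝ) * V.imaginaryPeriodRat = minusPeriod f) ∧
        ∃ L : IwasawaAlgebra p, IsQuadraticBranchMinusLFunction f p ϖ L := by
  intro V _ _ N _ f hf hgood hap
  obtain ⟨ϖ, hϖ, hrel⟩ := hper V f hf hgood hap
  exact ⟨ϖ, hrel, exists_isQuadraticBranchMinusLFunction_of_isNewformOf hp2 hf hgood hap ϖ hϖ⟩

end Curve

end Summit.BirchSwinnertonDyer.Rank1Residual.Additive

end
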